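import Summits.AtomisticToContinuum.HydrodynamicLimit.Theorems.JParityClosureKineticEnergyTailsApriori
import Literature.MathematicalPhysics.KineticTheory.HardSphereEulerProofs
import Literature.MathematicalPhysics.KineticTheory.HardSphereTwoTimePressure
import Literature.Analysis.FluidPDE.HardSphereCollisionRecord
import Literature.Analysis.FluidPDE.HardSphereDynamicsProofs
import HarnessLib

/-!
# Crux `EnergyCurrentTails` (stmt-AtomisticToContinuum-9235), line `quartic-schur-ledger`:
# preliminaries of the dock S2a″ ⟸ stmt-16939 (`stub_energyFluxCeilingWindows_of_oneRare`)

Helper lemmas (seat c5) for docking the line's all-windows energy-flux ceiling S2a″ onto the shared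
one-rare-participant contact-intensity ceiling `JeansLoadedDice.ContactIntensityDominationOneRare`
(stmt-AtomisticToContinuum-16939), proved in the companion file
`OneFlightGossipEngineEnergyCurrentTailsEnergyFluxCeilingOneRareDock`:

* `c5dock_ofReal_collisionSum_le_finsum` — LEFT SIDE: on the good set the line's real collision sum
  of the bilinear mark `‖v₁⁻‖²‖v₂⁻‖²` is dominated by the routes' `∑ᶠ` collision sum of any mark
  `ψ(v₁⁻)(1+‖v₂⁻‖)²` dominating it termwise (inline form `HardSphereFlow.collisionPairSum_eq_finsum_ite`
  of the Literature collision sums; self-contained, no import of the S2a-glue file of stmt-9218);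
* `c5dock_mark_le`, `c5dock_double_sum_le(_avg)` — RIGHT SIDE: the pointwise bound
  `‖v‖²(1+‖w‖)²‖v−w‖ ≤ 4(‖v‖³ + ‖v‖³‖w‖² + ‖w‖³ + ‖v‖²‖w‖³)` and Tonelli over two independent
  copies of the law, `≤ 8(N+1)² m₃(1 + m₂)` in the line's normalised moments;
* `c5dock_secondMoment_lower` — the uniform LOWER bound `m₂(r) ≥ 3 min θ₀` for `σ ≤ 1/2`, all `N`,
  all flows and all times (energy conservation on the conull good set,
  `IsHardSphereTrajectory.configEnergy_eq_holds`, and the Gaussian disintegration of the local Gibbs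
  datum, `lintegral_localGibbsMeasure`, and the landed one-body second moment
  `lintegral_norm_sq_gaussMeasure`: `∫ ‖v‖² dN(u, θ id) = ‖u‖² + 3θ`).
-/

noncomputable section

open MeasureTheory Set Filter
open scoped ENNReal InnerProductSpace

namespace Summit.AtomisticToContinuum.HydrodynamicLimit.Theorems.QuarticSchurLedger

open Literature.MathematicalPhysics.KineticTheory Literature.Analysis.FluidPDE

section LeftSide

variable {d X : Type*} [Fintype d] [MeasureSpace X] [TopologicalSpace X] {G : Geometry d X}
  {ε : ℝ} {n : ℕ}

/-- The termwise comparison of marks `‖v‖²‖w‖² ≤ ‖v‖² (1 + ‖w‖)²`, in `ℝ≥0∞`. [folklore] -/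
theorem c5dock_sq_mul_sq_le {E : Type*} [SeminormedAddCommGroup E] (v w : E) :
    ENNReal.ofReal (‖v‖ ^ 2 * ‖w‖ ^ 2) ≤
      ENNReal.ofReal (‖v‖ ^ 2) * ENNReal.ofReal ((1 + ‖w‖) ^ 2) := by
  rw [← ENNReal.ofReal_mul (by positivity)]
  refine ENNReal.ofReal_le_ofReal (mul_le_mul_of_nonneg_left ?_ (by positivity))
  exact pow_le_pow_left₀ (norm_nonneg _) (le_add_of_nonneg_left zero_le_one) 2

/-- **Left side of the dock.**  On the good set, the line's real collision sum of the bilinear mark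
`‖v₁⁻‖²‖v₂⁻‖²` over a bounded window is at most the routes' `∑ᶠ` collision sum of any mark
`ψ(v₁⁻) · ofReal((1 + ‖v₂⁻‖)²)` dominating it termwise (inline form
`HardSphereFlow.collisionPairSum_eq_finsum_ite` over the finite set of collision times of the window,
then a termwise comparison: on the good set the orbit stays in the hard-sphere domain, so the route's
contact indicator is the inline contact condition). [folklore] -/
theorem c5dock_ofReal_collisionSum_le_finsum (Φ : HardSphereFlow G ε n) {z : Config n d X}
    (hz : z ∈ Φ.good) {S : Set ℝ} {a b : ℝ} (hS : S ⊆ Icc a b)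
    (ψ : EuclideanSpace ℝ d → ℝ≥0∞)
    (hψ : ∀ v w : EuclideanSpace ℝ d, ENNReal.ofReal (‖v‖ ^ 2 * ‖w‖ ^ 2) ≤
      ψ v * ENNReal.ofReal ((1 + ‖w‖) ^ 2)) :
    ENNReal.ofReal (Φ.collisionSum S (fun col => ‖col.preVel.1‖ ^ 2 * ‖col.preVel.2‖ ^ 2) z) ≤
      ∑ᶠ t ∈ collisionTimes G ε (fun r => Φ.flow r z) ∩ S, ∑ i : Fin n, ∑ j : Fin n,
        if i = j then (0 : ℝ≥0∞) else (contactSet G n ε i j).indicator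
          (fun y => (fun p : EuclideanSpace ℝ d × EuclideanSpace ℝ d =>
              ψ p.1 * ENNReal.ofReal ((1 + ‖p.2‖) ^ 2))
            (((collidePair G i j y) i).2, ((collidePair G i j y) j).2)) (Φ.flow t z) := by
  classical
  have hfin := Φ.finite_collisionTimes_inter hz hS
  -- the inline (route) form of the real collision sum, over the finite set of collision times
  have hrepr : Φ.collisionSum S (fun col => ‖col.preVel.1‖ ^ 2 * ‖col.preVel.2‖ ^ 2) z =
      ∑ t ∈ hfin.toFinset, ∑ i : Fin n, ∑ j : Fin n,
        if i ≠ j ∧ ‖G.sepVec (Φ.flow t z i).1 (Φ.flow t z j).1‖ = ε then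
          ‖(HardSphereCollisionRecord.ofConfig G ε (Φ.flow t z) t i j).preVel.1‖ ^ 2 *
            ‖(HardSphereCollisionRecord.ofConfig G ε (Φ.flow t z) t i j).preVel.2‖ ^ 2
        else 0 := by
    rw [Φ.collisionSum_eq_collisionPairSum, Φ.collisionPairSum_eq_finsum_ite hz,
      finsum_mem_eq_finite_toFinset_sum _ hfin]
  have hnn : ∀ (t : ℝ) (i j : Fin n), (0 : ℝ) ≤
      if i ≠ j ∧ ‖G.sepVec (Φ.flow t z i).1 (Φ.flow t z j).1‖ = ε then
        ‖(HardSphereCollisionRecord.ofConfig G ε (Φ.flow t z) t i j).preVel.1‖ ^ 2 *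
          ‖(HardSphereCollisionRecord.ofConfig G ε (Φ.flow t z) t i j).preVel.2‖ ^ 2
      else 0 := fun t i j => by
    split_ifs
    · positivity
    · exact le_rfl
  rw [hrepr, finsum_mem_eq_finite_toFinset_sum _ hfin,
    ENNReal.ofReal_sum_of_nonneg fun t _ =>
      Finset.sum_nonneg fun i _ => Finset.sum_nonneg fun j _ => hnn t i j]
  refine Finset.sum_le_sum fun t _ => ?_
  rw [ENNReal.ofReal_sum_of_nonneg fun i _ => Finset.sum_nonneg fun j _ => hnn t i j]
  refine Finset.sum_le_sum fun i _ => ?_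
  rw [ENNReal.ofReal_sum_of_nonneg fun j _ => hnn t i j]
  refine Finset.sum_le_sum fun j _ => ?_
  by_cases hij : i = j
  · simp [hij]
  · have hdom : Φ.flow t z ∈ hardSphereDomain G n ε := (Φ.isTrajectory z hz).mem t
    by_cases hc : ‖G.sepVec (Φ.flow t z i).1 (Φ.flow t z j).1‖ = ε
    · have hmem : Φ.flow t z ∈ contactSet G n ε i j := mem_contactSet.2 ⟨hdom, hc⟩
      rw [if_pos ⟨hij, hc⟩, if_neg hij, Set.indicator_of_mem hmem,
        HardSphereCollisionRecord.ofConfig_preVel_eq_collidePair _ _ _ _ hij]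
      exact hψ _ _
    · have hnmem : Φ.flow t z ∉ contactSet G n ε i j := fun h => hc (mem_contactSet.1 h).2
      rw [if_neg fun h => hc h.2, if_neg hij, Set.indicator_of_notMem hnmem, ENNReal.ofReal_zero]

end LeftSide

section Pointwise

/-- The elementary polynomial inequality behind the one-rare-participant bookkeeping: for
`a, b ≥ 0`, `a²(1+b)²(a+b) ≤ 4(a³ + a³b² + b³ + a²b³)` (Young: `a²b ≤ (2a³+b³)/3`,
`2a²b² ≤ a²b + a²b³`). [folklore] -/
theorem c5dock_real_mark_le {a b : ℝ} (ha : 0 ≤ a) (hb : 0 ≤ b) :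
    a ^ 2 * (1 + b) ^ 2 * (a + b) ≤
      4 * (a ^ 3 * b ^ 0 + a ^ 3 * b ^ 2 + a ^ 0 * b ^ 3 + a ^ 2 * b ^ 3) := by
  simp only [pow_zero, mul_one, one_mul]
  have h1 : 0 ≤ (a - b) ^ 2 * (2 * a + b) := mul_nonneg (sq_nonneg _) (by linarith)
  have h2 : 0 ≤ a ^ 2 * (b * (b - 1) ^ 2) :=
    mul_nonneg (sq_nonneg _) (mul_nonneg hb (sq_nonneg _))
  have h3 : 0 ≤ a ^ 3 * (3 * b ^ 2 - 2 * b + 5 / 3) :=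
    mul_nonneg (pow_nonneg ha 3) (by nlinarith [sq_nonneg (b - 1 / 3)])
  nlinarith [h1, h2, h3, pow_nonneg hb 3, mul_nonneg (pow_nonneg ha 2) (pow_nonneg hb 3)]

/-- The pointwise bound on the Boltzmann–Enskog side of the dock, in `ℝ≥0∞`:
`‖v‖² (1+‖w‖)² ‖v − w‖ ≤ 4 (‖v‖³‖w‖⁰ + ‖v‖³‖w‖² + ‖v‖⁰‖w‖³ + ‖v‖²‖w‖³)`. [folklore] -/
theorem c5dock_mark_le {E : Type*} [SeminormedAddCommGroup E] (v w : E) :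
    ENNReal.ofReal (‖v‖ ^ 2) * ENNReal.ofReal ((1 + ‖w‖) ^ 2) * ENNReal.ofReal ‖v - w‖ ≤
      4 * (ENNReal.ofReal (‖v‖ ^ 3) * ENNReal.ofReal (‖w‖ ^ 0) +
        ENNReal.ofReal (‖v‖ ^ 3) * ENNReal.ofReal (‖w‖ ^ 2) +
        ENNReal.ofReal (‖v‖ ^ 0) * ENNReal.ofReal (‖w‖ ^ 3) +
        ENNReal.ofReal (‖v‖ ^ 2) * ENNReal.ofReal (‖w‖ ^ 3)) := by
  have key : ‖v‖ ^ 2 * (1 + ‖w‖) ^ 2 * ‖v - w‖ ≤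
      4 * (‖v‖ ^ 3 * ‖w‖ ^ 0 + ‖v‖ ^ 3 * ‖w‖ ^ 2 + ‖v‖ ^ 0 * ‖w‖ ^ 3 + ‖v‖ ^ 2 * ‖w‖ ^ 3) :=
    calc ‖v‖ ^ 2 * (1 + ‖w‖) ^ 2 * ‖v - w‖ ≤ ‖v‖ ^ 2 * (1 + ‖w‖) ^ 2 * (‖v‖ + ‖w‖) :=
          mul_le_mul_of_nonneg_left (norm_sub_le v w) (by positivity)
      _ ≤ _ := c5dock_real_mark_le (norm_nonneg v) (norm_nonneg w)
  calc ENNReal.ofReal (‖v‖ ^ 2) * ENNReal.ofReal ((1 + ‖w‖) ^ 2) * ENNReal.ofReal ‖v - w‖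
      = ENNReal.ofReal (‖v‖ ^ 2 * (1 + ‖w‖) ^ 2 * ‖v - w‖) := by
        rw [← ENNReal.ofReal_mul (by positivity), ← ENNReal.ofReal_mul (by positivity)]
    _ ≤ ENNReal.ofReal (4 * (‖v‖ ^ 3 * ‖w‖ ^ 0 + ‖v‖ ^ 3 * ‖w‖ ^ 2 + ‖v‖ ^ 0 * ‖w‖ ^ 3 +
          ‖v‖ ^ 2 * ‖w‖ ^ 3)) := ENNReal.ofReal_le_ofReal key
    _ = _ := by
        rw [ENNReal.ofReal_mul (by norm_num), ENNReal.ofReal_add (by positivity) (by positivity),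
          ENNReal.ofReal_add (by positivity) (by positivity),
          ENNReal.ofReal_add (by positivity) (by positivity),
          ENNReal.ofReal_mul (by positivity), ENNReal.ofReal_mul (by positivity),
          ENNReal.ofReal_mul (by positivity), ENNReal.ofReal_mul (by positivity),
          ENNReal.ofReal_ofNat]

end Pointwise

section Product

variable {N : ℕ} {ε : ℝ}

/-- **The product (Tonelli) estimate of the dock.**  For two independent copies of any law `μ`,
`∫∫ Σᵢ Σⱼ ‖vᵢ‖² (1+‖wⱼ‖)² ‖vᵢ − wⱼ‖ dμ dμ ≤ 4 (A₃ (A₀ + A₂) + (A₀ + A₂) A₃)` with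
`A_k = ∫ Σᵢ ofReal ‖vᵢ(r)‖ᵏ dμ`. [folklore] -/
theorem c5dock_double_sum_le
    (Φ : HardSphereFlow (Torus.geometry (Fin 3)) ε (N + 1))
    (μ : Measure (Config (N + 1) (Fin 3) T3)) (r : ℝ) :
    (∫⁻ z, ∫⁻ z', ∑ i : Fin (N + 1), ∑ j : Fin (N + 1),
        ENNReal.ofReal (‖(Φ.flow r z i).2‖ ^ 2) *
          ENNReal.ofReal ((1 + ‖(Φ.flow r z' j).2‖) ^ 2) *
          ENNReal.ofReal ‖(Φ.flow r z i).2 - (Φ.flow r z' j).2‖ ∂μ ∂μ) ≤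
      4 * ((∫⁻ z, ∑ i : Fin (N + 1), ENNReal.ofReal (‖(Φ.flow r z i).2‖ ^ 3) ∂μ) *
          ((∫⁻ z, ∑ i : Fin (N + 1), ENNReal.ofReal (‖(Φ.flow r z i).2‖ ^ 0) ∂μ) +
            (∫⁻ z, ∑ i : Fin (N + 1), ENNReal.ofReal (‖(Φ.flow r z i).2‖ ^ 2) ∂μ)) +
        ((∫⁻ z, ∑ i : Fin (N + 1), ENNReal.ofReal (‖(Φ.flow r z i).2‖ ^ 0) ∂μ) +
            (∫⁻ z, ∑ i : Fin (N + 1), ENNReal.ofReal (‖(Φ.flow r z i).2‖ ^ 2) ∂μ)) *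
          (∫⁻ z, ∑ i : Fin (N + 1), ENNReal.ofReal (‖(Φ.flow r z i).2‖ ^ 3) ∂μ)) := by
  -- abbreviations
  set a : ℕ → Config (N + 1) (Fin 3) T3 → ℝ≥0∞ :=
    fun k z => ∑ i : Fin (N + 1), ENNReal.ofReal (‖(Φ.flow r z i).2‖ ^ k) with ha
  have hma : ∀ k, Measurable (a k) := fun k => by
    rw [ha]
    exact Finset.measurable_sum _ fun i _ => ENNReal.measurable_ofReal.comp
      ((((measurable_pi_apply i).comp (Φ.measurable_flow r)).snd.norm).pow_const k)
  set b : Config (N + 1) (Fin 3) T3 → ℝ≥0∞ := fun z => a 0 z + a 2 z with hb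
  have hmb : Measurable b := (hma 0).fun_add (hma 2)
  have hB : (∫⁻ z, b z ∂μ) = (∫⁻ z, a 0 z ∂μ) + (∫⁻ z, a 2 z ∂μ) := lintegral_add_left (hma 0) _
  -- pointwise bound on the double sum
  have hpt : ∀ z z', (∑ i : Fin (N + 1), ∑ j : Fin (N + 1),
      ENNReal.ofReal (‖(Φ.flow r z i).2‖ ^ 2) *
        ENNReal.ofReal ((1 + ‖(Φ.flow r z' j).2‖) ^ 2) *
        ENNReal.ofReal ‖(Φ.flow r z i).2 - (Φ.flow r z' j).2‖) ≤
      4 * (a 3 z * b z' + b z * a 3 z') := by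
    intro z z'
    calc (∑ i : Fin (N + 1), ∑ j : Fin (N + 1),
          ENNReal.ofReal (‖(Φ.flow r z i).2‖ ^ 2) *
            ENNReal.ofReal ((1 + ‖(Φ.flow r z' j).2‖) ^ 2) *
            ENNReal.ofReal ‖(Φ.flow r z i).2 - (Φ.flow r z' j).2‖)
        ≤ ∑ i : Fin (N + 1), ∑ j : Fin (N + 1),
            4 * (ENNReal.ofReal (‖(Φ.flow r z i).2‖ ^ 3) * ENNReal.ofReal (‖(Φ.flow r z' j).2‖ ^ 0) +
              ENNReal.ofReal (‖(Φ.flow r z i).2‖ ^ 3) * ENNReal.ofReal (‖(Φ.flow r z' j).2‖ ^ 2) +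
              ENNReal.ofReal (‖(Φ.flow r z i).2‖ ^ 0) * ENNReal.ofReal (‖(Φ.flow r z' j).2‖ ^ 3) +
              ENNReal.ofReal (‖(Φ.flow r z i).2‖ ^ 2) *
                ENNReal.ofReal (‖(Φ.flow r z' j).2‖ ^ 3)) :=
          Finset.sum_le_sum fun i _ => Finset.sum_le_sum fun j _ => c5dock_mark_le _ _
      _ = 4 * (a 3 z * a 0 z' + a 3 z * a 2 z' + a 0 z * a 3 z' + a 2 z * a 3 z') := by
          rw [ha]
          simp only [← Finset.mul_sum, Finset.sum_add_distrib, Finset.sum_mul_sum]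
      _ = 4 * (a 3 z * b z' + b z * a 3 z') := by rw [hb]; ring
  calc (∫⁻ z, ∫⁻ z', ∑ i : Fin (N + 1), ∑ j : Fin (N + 1),
        ENNReal.ofReal (‖(Φ.flow r z i).2‖ ^ 2) *
          ENNReal.ofReal ((1 + ‖(Φ.flow r z' j).2‖) ^ 2) *
          ENNReal.ofReal ‖(Φ.flow r z i).2 - (Φ.flow r z' j).2‖ ∂μ ∂μ)
      ≤ ∫⁻ z, ∫⁻ z', 4 * (a 3 z * b z' + b z * a 3 z') ∂μ ∂μ :=
        lintegral_mono fun z => lintegral_mono fun z' => hpt z z'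
    _ = ∫⁻ z, 4 * (a 3 z * (∫⁻ z', b z' ∂μ) + b z * (∫⁻ z', a 3 z' ∂μ)) ∂μ := by
        refine lintegral_congr fun z => ?_
        rw [lintegral_const_mul _ ((hmb.const_mul _).fun_add ((hma 3).const_mul _)),
          lintegral_add_left (hmb.const_mul _), lintegral_const_mul _ hmb,
          lintegral_const_mul _ (hma 3)]
    _ = 4 * ((∫⁻ z, a 3 z ∂μ) * (∫⁻ z', b z' ∂μ) + (∫⁻ z, b z ∂μ) * (∫⁻ z', a 3 z' ∂μ)) := by
        rw [lintegral_const_mul _ (((hma 3).mul_const _).fun_add (hmb.mul_const _)),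
          lintegral_add_left ((hma 3).mul_const _), lintegral_mul_const _ (hma 3),
          lintegral_mul_const _ hmb]
    _ = 4 * ((∫⁻ z, a 3 z ∂μ) * ((∫⁻ z, a 0 z ∂μ) + (∫⁻ z, a 2 z ∂μ)) +
          ((∫⁻ z, a 0 z ∂μ) + (∫⁻ z, a 2 z ∂μ)) * (∫⁻ z, a 3 z ∂μ)) := by rw [hB]

/-- `A₀ = ∫ Σᵢ ofReal ‖vᵢ‖⁰ dμ = ofReal (N+1)` for a probability measure `μ`. [folklore] -/
theorem c5dock_lintegral_sum_pow_zero
    (Φ : HardSphereFlow (Torus.geometry (Fin 3)) ε (N + 1))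
    (μ : Measure (Config (N + 1) (Fin 3) T3)) [IsProbabilityMeasure μ] (r : ℝ) :
    (∫⁻ z, ∑ i : Fin (N + 1), ENNReal.ofReal (‖(Φ.flow r z i).2‖ ^ 0) ∂μ) =
      ENNReal.ofReal ((N : ℝ) + 1) := by
  simp only [pow_zero, ENNReal.ofReal_one, Finset.sum_const, Finset.card_univ, Fintype.card_fin,
    nsmul_eq_mul, mul_one, lintegral_const, measure_univ]
  rw [ENNReal.ofReal_add (by positivity) zero_le_one, ENNReal.ofReal_natCast, ENNReal.ofReal_one]
  push_cast
  ring

/-- **The product estimate in the line's normalised moments.**  For a probability measure `μ`,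
`∫∫ Σᵢ Σⱼ ‖vᵢ‖² (1+‖wⱼ‖)² ‖vᵢ − wⱼ‖ dμ dμ ≤ (N+1)² · 8 · m₃ (1 + m₂)` with
`m_k = ∫ ofReal ((N+1)⁻¹ Σᵢ ‖vᵢ(r)‖ᵏ) dμ`. [folklore] -/
theorem c5dock_double_sum_le_avg
    (Φ : HardSphereFlow (Torus.geometry (Fin 3)) ε (N + 1))
    (μ : Measure (Config (N + 1) (Fin 3) T3)) [IsProbabilityMeasure μ] (r : ℝ) :
    (∫⁻ z, ∫⁻ z', ∑ i : Fin (N + 1), ∑ j : Fin (N + 1),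
        ENNReal.ofReal (‖(Φ.flow r z i).2‖ ^ 2) *
          ENNReal.ofReal ((1 + ‖(Φ.flow r z' j).2‖) ^ 2) *
          ENNReal.ofReal ‖(Φ.flow r z i).2 - (Φ.flow r z' j).2‖ ∂μ ∂μ) ≤
      ENNReal.ofReal (((N : ℝ) + 1) * ((N : ℝ) + 1)) *
        (8 * ((∫⁻ z, ENNReal.ofReal (((N : ℝ) + 1)⁻¹ *
            ∑ i : Fin (N + 1), ‖(Φ.flow r z i).2‖ ^ 3) ∂μ) *
          (1 + ∫⁻ z, ENNReal.ofReal (((N : ℝ) + 1)⁻¹ *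
            ∑ i : Fin (N + 1), ‖(Φ.flow r z i).2‖ ^ 2) ∂μ))) := by
  have hN1 : (0 : ℝ) ≤ (N : ℝ) + 1 := by positivity
  have hN0 : (N : ℝ) + 1 ≠ 0 := by positivity
  -- `A_k = ofReal (N+1) · m_k`
  have havg : ∀ k : ℕ, (∫⁻ z, ∑ i : Fin (N + 1), ENNReal.ofReal (‖(Φ.flow r z i).2‖ ^ k) ∂μ) =
      ENNReal.ofReal ((N : ℝ) + 1) *
        ∫⁻ z, ENNReal.ofReal (((N : ℝ) + 1)⁻¹ *
          ∑ i : Fin (N + 1), ‖(Φ.flow r z i).2‖ ^ k) ∂μ := by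
    intro k
    rw [← lintegral_const_mul' _ _ ENNReal.ofReal_ne_top]
    refine lintegral_congr fun z => ?_
    rw [← ENNReal.ofReal_sum_of_nonneg fun i _ => by positivity, ← ENNReal.ofReal_mul hN1,
      ← mul_assoc, mul_inv_cancel₀ hN0, one_mul]
  refine (c5dock_double_sum_le Φ μ r).trans_eq ?_
  rw [c5dock_lintegral_sum_pow_zero Φ μ r, havg 3, havg 2, ENNReal.ofReal_mul hN1]
  ring

end Product

section LowerBound

/-- **Per-particle second moment under the local Gibbs law, from below**: if `θm ≤ θ₀` then for
`σ ≤ 1/2` and every particle `i`, `ofReal (3 θm) ≤ ∫ ofReal ‖vᵢ‖² dλ_N` (disintegration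
`lintegral_localGibbsMeasure` into positions and independent Gaussian velocities, the one-body
second moment `lintegral_norm_sq_gaussMeasure`: `∫ ‖v‖² dN(u, θ id) = ‖u‖² + 3θ`; the position
marginal has mass one, `lintegral_posWeight_eq_one`). [folklore] -/
theorem c5dock_lintegral_norm_sq_localGibbsLaw_ge {a₀ θ₀ : T3 → ℝ} {u₀ : T3 → V3}
    (ha : Continuous a₀) (hθ : Continuous θ₀) (hu : Continuous u₀)
    (ha0 : ∀ x, 0 < a₀ x) (hθ0 : ∀ x, 0 < θ₀ x) {θm : ℝ} (hθm : ∀ x, θm ≤ θ₀ x)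
    {σ : ℝ} (hσ2 : σ ≤ 1 / 2) (N : ℕ)
    (Φ : HardSphereFlow (Torus.geometry (Fin 3)) (hsDiameter σ N) (N + 1)) (i : Fin (N + 1)) :
    ENNReal.ofReal (3 * θm) ≤
      ∫⁻ z, ENNReal.ofReal (‖(z i).2‖ ^ 2) ∂(localGibbsLaw σ a₀ u₀ θ₀ N Φ) := by
  have ha0' : ∀ x, 0 ≤ a₀ x := fun x => (ha0 x).le
  haveI := isProbabilityMeasure_localGibbsMeasure ha hθ hu ha0 hθ0 hσ2 N
  have hG : Measurable fun z : Config (N + 1) (Fin 3) T3 => ENNReal.ofReal (‖(z i).2‖ ^ 2) :=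
    ((measurable_pi_apply i).snd.norm.pow_const 2).ennreal_ofReal
  have hg : Measurable fun w : V3 => ENNReal.ofReal (‖w‖ ^ 2) :=
    (measurable_norm.pow_const 2).ennreal_ofReal
  have hZm : Measurable fun x : Fin (N + 1) → T3 => ENNReal.ofReal
      ((canonicalPartition (Torus.geometry (Fin 3)) (hsDiameter σ N) (N + 1)
        (localGibbsProfile a₀ u₀ θ₀))⁻¹ * posWeight a₀ (hsDiameter σ N) (N + 1) x) :=
    ((measurable_posWeight ha _ _).const_mul _).ennreal_ofReal
  -- the one-body inner bound, uniformly in the positions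
  have hinner : ∀ x : Fin (N + 1) → T3,
      ENNReal.ofReal (3 * θm) ≤ ∫⁻ v, ENNReal.ofReal (‖v i‖ ^ 2) ∂velMeasure u₀ θ₀ x := by
    intro x
    have hmp : MeasurePreserving (Function.eval i) (velMeasure u₀ θ₀ x)
        (gaussMeasure (u₀ (x i)) (θ₀ (x i))) := by
      unfold velMeasure
      exact measurePreserving_eval _ i
    calc ENNReal.ofReal (3 * θm) ≤ ENNReal.ofReal (‖u₀ (x i)‖ ^ 2 + 3 * θ₀ (x i)) :=
          ENNReal.ofReal_le_ofReal (by nlinarith [hθm (x i), sq_nonneg ‖u₀ (x i)‖])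
      _ = ∫⁻ w, ENNReal.ofReal (‖w‖ ^ 2) ∂gaussMeasure (u₀ (x i)) (θ₀ (x i)) :=
          (lintegral_norm_sq_gaussMeasure _ (hθ0 _)).symm
      _ = ∫⁻ v, ENNReal.ofReal (‖v i‖ ^ 2) ∂velMeasure u₀ θ₀ x := (hmp.lintegral_comp hg).symm
  rw [localGibbsLaw_eq, lintegral_localGibbsMeasure ha hθ hu ha0' hθ0 σ N hG]
  simp only [zipConfig_apply]
  calc ENNReal.ofReal (3 * θm)
      = (∫⁻ x, ENNReal.ofReal ((canonicalPartition (Torus.geometry (Fin 3)) (hsDiameter σ N)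
          (N + 1) (localGibbsProfile a₀ u₀ θ₀))⁻¹ * posWeight a₀ (hsDiameter σ N) (N + 1) x)) *
          ENNReal.ofReal (3 * θm) := by
        rw [lintegral_posWeight_eq_one ha hθ hu ha0' hθ0 σ N, one_mul]
    _ = ∫⁻ x, ENNReal.ofReal ((canonicalPartition (Torus.geometry (Fin 3)) (hsDiameter σ N)
          (N + 1) (localGibbsProfile a₀ u₀ θ₀))⁻¹ * posWeight a₀ (hsDiameter σ N) (N + 1) x) *
          ENNReal.ofReal (3 * θm) := (lintegral_mul_const _ hZm).symm
    _ ≤ _ := lintegral_mono fun x => mul_le_mul_right (hinner x) _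

/-- **Uniform lower bound on the bulk second moment along the flow**: if `θm ≤ θ₀` then for
`σ ≤ 1/2`, every `N`, every flow and EVERY time `r`,
`ofReal (3 θm) ≤ m₂(r) = ∫ ofReal ((N+1)⁻¹ Σᵢ ‖vᵢ(r)‖²) dλ_N`: the kinetic energy is conserved
on the conull good set (`IsHardSphereTrajectory.configEnergy_eq_holds`, `Φ_0 = id`), so
`m₂(r) = m₂(0)`, and at time `0` the per-particle Gaussian bound
`c5dock_lintegral_norm_sq_localGibbsLaw_ge` is averaged over the particles.  (Registered helper
stub of stmt-AtomisticToContinuum-9235 for this preliminary file.) [folklore] -/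
theorem c5dock_secondMoment_lower :
    ∀ (a₀ θ₀ : T3 → ℝ) (u₀ : T3 → V3), Continuous a₀ → Continuous θ₀ → Continuous u₀ →
      (∀ x, 0 < a₀ x) → (∀ x, 0 < θ₀ x) → ∀ θm : ℝ, (∀ x, θm ≤ θ₀ x) →
      ∀ σ : ℝ, σ ≤ 1 / 2 → ∀ (N : ℕ)
        (Φ : HardSphereFlow (Torus.geometry (Fin 3)) (hsDiameter σ N) (N + 1)) (r : ℝ),
        ENNReal.ofReal (3 * θm) ≤
          ∫⁻ z, ENNReal.ofReal (((N : ℝ) + 1)⁻¹ * ∑ i : Fin (N + 1), ‖(Φ.flow r z i).2‖ ^ 2)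
            ∂(localGibbsLaw σ a₀ u₀ θ₀ N Φ) := by
  intro a₀ θ₀ u₀ ha hθ hu ha0 hθ0 θm hθm σ hσ2 N Φ r
  have hc : (0 : ℝ) ≤ ((N : ℝ) + 1)⁻¹ := by positivity
  have hN : ((N : ℝ) + 1) ≠ 0 := by positivity
  have hmeas : ∀ i : Fin (N + 1),
      Measurable fun z : Config (N + 1) (Fin 3) T3 => ENNReal.ofReal (‖(z i).2‖ ^ 2) :=
    fun i => ((measurable_pi_apply i).snd.norm.pow_const 2).ennreal_ofReal
  -- energy conservation on the good set: `m₂(r) = m₂(0)`, with `Φ_0 = id`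
  have hflow : (∫⁻ z, ENNReal.ofReal (((N : ℝ) + 1)⁻¹ *
        ∑ i : Fin (N + 1), ‖(Φ.flow r z i).2‖ ^ 2) ∂(localGibbsLaw σ a₀ u₀ θ₀ N Φ)) =
      ∫⁻ z, ENNReal.ofReal (((N : ℝ) + 1)⁻¹) *
        ∑ i : Fin (N + 1), ENNReal.ofReal (‖(z i).2‖ ^ 2) ∂(localGibbsLaw σ a₀ u₀ θ₀ N Φ) := by
    refine lintegral_congr_ae ?_
    filter_upwards [ae_mem_good_localGibbsLaw σ a₀ u₀ θ₀ N Φ] with z hz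
    have hE : ∑ i, ‖(Φ.flow r z i).2‖ ^ 2 = ∑ i, ‖(z i).2‖ ^ 2 := by
      have h := IsHardSphereTrajectory.configEnergy_eq_holds (Φ.isTrajectory z hz) r 0
      simp only [configEnergy] at h
      rw [Φ.flow_zero z hz] at h
      linarith
    rw [hE, ENNReal.ofReal_mul hc, ENNReal.ofReal_sum_of_nonneg fun i _ => by positivity]
  rw [hflow, lintegral_const_mul _ (Finset.measurable_sum _ fun i _ => hmeas i),
    lintegral_finsetSum _ fun i _ => hmeas i]
  calc ENNReal.ofReal (3 * θm)
      = ENNReal.ofReal (((N : ℝ) + 1)⁻¹) * ∑ _i : Fin (N + 1), ENNReal.ofReal (3 * θm) := by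
        rw [Finset.sum_const, Finset.card_univ, Fintype.card_fin, nsmul_eq_mul, ← mul_assoc,
          ← ENNReal.ofReal_natCast, ← ENNReal.ofReal_mul hc]
        push_cast
        rw [inv_mul_cancel₀ hN, ENNReal.ofReal_one, one_mul]
    _ ≤ _ := by
        gcongr with i _
        exact c5dock_lintegral_norm_sq_localGibbsLaw_ge ha hθ hu ha0 hθ0 hθm hσ2 N Φ i

end LowerBound

end Summit.AtomisticToContinuum.HydrodynamicLimit.Theorems.QuarticSchurLedger

end
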